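import Mathlib
import HarnessLib
import Literature.Probability.Percolation.BlockResampling
import Literature.Probability.Percolation.InfiniteClusterDensity
import Literature.Probability.Percolation.BondPercolationSymmetry
import Literature.Probability.Percolation.PercolationProofs
import Summits.CriticalPhenomena.PercolationContinuityZ3.Theorems.PercTreeValueTetrahedronHarrisGapStubMirror
import Summits.CriticalPhenomena.PercolationContinuityZ3.Theorems.PercTreeValueTetrahedronHarrisGapStubCondHarris

/-!
# Crux `PercTreeValue.TetrahedronHarrisGap` (stmt-CriticalPhenomena-7799), line `SketchIdeator1` (rev 5):
# sub-goal `coherenceAt_iff_antiVar_le` (isotropy form of `stub_coherence`)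

Helper file for the crux skeleton `Cruxes/TetrahedronHarrisGap/Lines/SketchIdeator1.lean`
(lead prover-line-stmt-CriticalPhenomena-7799-c1-0), `--supports stmt-CriticalPhenomena-7799`.
No new definitions; everything is stated in the tree's vocabulary (`blockCondProb`, `armEdges`,
`openConn`, `bondPercolation`, `zdGraph`, `criticalProbI`).

With the corner block `K_r` (the lattice edges touching the four corner boxes of sup-radius `r/8` around
`0`, `a_r = (r,r,0)`, `b_r = (r,0,r)`, `c_r = (0,r,r)`) and the two bulk hook probabilities
`f_r = P(0 ↔ a_r | ω off K_r)`, `g_r = P(b_r ↔ c_r | ω off K_r)` (`blockCondProb`), the line's open stub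
`stub_coherence` reads `c · Var f_r ≤ Cov(f_r, g_r)`.  By the landed mirror symmetry `stub_mirror`
(`g_r = f_r ∘ σ̂_r` for a `P_{p_c}`-preserving relabelling `σ̂_r`, `bondPercolation_map_relabel_iso`)
the laws of `f_r` and `g_r` coincide, in particular `∫ g_r = ∫ f_r` (`integral_mirror_eq`) and
`∫ g_r² = ∫ f_r²` (`integral_mirror_sq_eq`).  Writing `u = (f + g)/2`, `v = (f − g)/2` (so `∫ v = 0`),
`Var f = Var u + Var v` and `Cov(f, g) = Var u − Var v`, whence the registered equivalence

  `c · Var f ≤ Cov(f, g)  ↔  (1 + c) · Var v ≤ (1 − c) · Var u`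

(`coherenceAt_iff_antiVar_le`): coherence is the statement that the antisymmetric part of `f` carries at
most the fraction `(1 − c)/2` of the variance.  The proof is integral bookkeeping (`integral_add`,
`integral_sub`, `integral_div`, boundedness of `blockCondProb`) followed by `linarith`.
-/

noncomputable section

open MeasureTheory Literature.Probability.Percolation Literature.Probability.LatticeModels

namespace Summit.CriticalPhenomena.PercolationContinuityZ3.Theorems.TetrahedronHarrisGap

/-- **Invariance of `P_p`-integrals under graph automorphisms.** For a graph automorphism `φ` of `G`
and any real function `F` of the configuration, `∫ F (φ '' ω) dP_p(ω) = ∫ F dP_p`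
(`bondPercolation_map_relabel_iso` and the change of variables along the measurable equivalence
`BondConfig.relabel`, `integral_map_equiv`; no measurability of `F` is needed). -/
theorem integral_comp_relabel_iso {V : Type*} {G : SimpleGraph V} (φ : G ≃g G) (p : unitInterval)
    (F : BondConfig V → ℝ) :
    ∫ ω, F (BondConfig.relabel (sym2Equiv φ.toEquiv) ω) ∂(bondPercolation G p) =
      ∫ ω, F ω ∂(bondPercolation G p) := by
  rw [← integral_map_equiv, bondPercolation_map_relabel_iso]

/-- **Mirror symmetry of the means**: `∫ g_r dP_{p_c} = ∫ f_r dP_{p_c}` — the bulk hook probability of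
the pair `(b_r, c_r)` is the one of `(0, a_r)` composed with the `P_{p_c}`-preserving lattice involution of
`stub_mirror`. -/
theorem integral_mirror_eq (r : ℕ) :
    ∫ ω, blockCondProb (zdGraph 3) (criticalProbI 3)
        (armEdges (r / 8) (0 : Site 3) ∪ armEdges (r / 8) ![(r : ℤ), (r : ℤ), 0] ∪
          armEdges (r / 8) ![(r : ℤ), 0, (r : ℤ)] ∪ armEdges (r / 8) ![0, (r : ℤ), (r : ℤ)])
        (openConn ![(r : ℤ), 0, (r : ℤ)] ![0, (r : ℤ), (r : ℤ)]) ω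
        ∂(bondPercolation (zdGraph 3) (criticalProbI 3)) =
      ∫ ω, blockCondProb (zdGraph 3) (criticalProbI 3)
        (armEdges (r / 8) (0 : Site 3) ∪ armEdges (r / 8) ![(r : ℤ), (r : ℤ), 0] ∪
          armEdges (r / 8) ![(r : ℤ), 0, (r : ℤ)] ∪ armEdges (r / 8) ![0, (r : ℤ), (r : ℤ)])
        (openConn (0 : Site 3) ![(r : ℤ), (r : ℤ), 0]) ω
        ∂(bondPercolation (zdGraph 3) (criticalProbI 3)) := by
  obtain ⟨φ, -, -, -, -, hgf, -⟩ := stub_mirror r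
  simp_rw [hgf]
  exact integral_comp_relabel_iso φ (criticalProbI 3) _

/-- **Mirror symmetry of the second moments**: `∫ g_r² dP_{p_c} = ∫ f_r² dP_{p_c}` (same involution). -/
theorem integral_mirror_sq_eq (r : ℕ) :
    ∫ ω, blockCondProb (zdGraph 3) (criticalProbI 3)
        (armEdges (r / 8) (0 : Site 3) ∪ armEdges (r / 8) ![(r : ℤ), (r : ℤ), 0] ∪
          armEdges (r / 8) ![(r : ℤ), 0, (r : ℤ)] ∪ armEdges (r / 8) ![0, (r : ℤ), (r : ℤ)])
        (openConn ![(r : ℤ), 0, (r : ℤ)] ![0, (r : ℤ), (r : ℤ)]) ω ^ 2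
        ∂(bondPercolation (zdGraph 3) (criticalProbI 3)) =
      ∫ ω, blockCondProb (zdGraph 3) (criticalProbI 3)
        (armEdges (r / 8) (0 : Site 3) ∪ armEdges (r / 8) ![(r : ℤ), (r : ℤ), 0] ∪
          armEdges (r / 8) ![(r : ℤ), 0, (r : ℤ)] ∪ armEdges (r / 8) ![0, (r : ℤ), (r : ℤ)])
        (openConn (0 : Site 3) ![(r : ℤ), (r : ℤ), 0]) ω ^ 2
        ∂(bondPercolation (zdGraph 3) (criticalProbI 3)) := by
  obtain ⟨φ, -, -, -, -, hgf, -⟩ := stub_mirror r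
  simp_rw [hgf]
  exact integral_comp_relabel_iso φ (criticalProbI 3) fun ω => _ ^ 2

/-- **coherenceAt_iff_antiVar_le** (registered sub-goal of stmt-CriticalPhenomena-7799, line `SketchIdeator1`
rev 5; the isotropy form of `stub_coherence`). With `f = f_r`, `g = g_r` the two bulk hook probabilities and
`P = P_{p_c}`: `c · Var f ≤ Cov(f, g) ↔ (1 + c) · Var((f − g)/2) ≤ (1 − c) · Var((f + g)/2)`.
Since `∫ g = ∫ f` and `∫ g² = ∫ f²` (mirror symmetry, `integral_mirror_eq`, `integral_mirror_sq_eq`), with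
`I₁ = ∫ f`, `I₂ = ∫ f²`, `J = ∫ f g` both sides are the linear inequality `c (I₂ − I₁²) ≤ J − I₁²`:
`∫ ((f − g)/2)² = (I₂ − J)/2`, `∫ (f − g)/2 = 0`, `∫ ((f + g)/2)² = (I₂ + J)/2`, `∫ (f + g)/2 = I₁`. -/
theorem coherenceAt_iff_antiVar_le :
    ∀ (r : ℕ) (c : ℝ),
      let K : Finset (Sym2 (Site 3)) :=
        armEdges (r / 8) (0 : Site 3) ∪ armEdges (r / 8) ![(r : ℤ), (r : ℤ), 0] ∪
          armEdges (r / 8) ![(r : ℤ), 0, (r : ℤ)] ∪ armEdges (r / 8) ![0, (r : ℤ), (r : ℤ)];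
      let f : BondConfig (Site 3) → ℝ :=
        blockCondProb (zdGraph 3) (criticalProbI 3) K (openConn (0 : Site 3) ![(r : ℤ), (r : ℤ), 0]);
      let g : BondConfig (Site 3) → ℝ :=
        blockCondProb (zdGraph 3) (criticalProbI 3) K (openConn ![(r : ℤ), 0, (r : ℤ)] ![0, (r : ℤ), (r : ℤ)]);
      (c * (∫ ω, f ω ^ 2 ∂(bondPercolation (zdGraph 3) (criticalProbI 3)) -
            (∫ ω, f ω ∂(bondPercolation (zdGraph 3) (criticalProbI 3))) ^ 2) ≤
          ∫ ω, f ω * g ω ∂(bondPercolation (zdGraph 3) (criticalProbI 3)) -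
            (∫ ω, f ω ∂(bondPercolation (zdGraph 3) (criticalProbI 3))) *
              (∫ ω, g ω ∂(bondPercolation (zdGraph 3) (criticalProbI 3)))) ↔
        ((1 + c) * (∫ ω, ((f ω - g ω) / 2) ^ 2 ∂(bondPercolation (zdGraph 3) (criticalProbI 3)) -
              (∫ ω, (f ω - g ω) / 2 ∂(bondPercolation (zdGraph 3) (criticalProbI 3))) ^ 2) ≤
          (1 - c) * (∫ ω, ((f ω + g ω) / 2) ^ 2 ∂(bondPercolation (zdGraph 3) (criticalProbI 3)) -
              (∫ ω, (f ω + g ω) / 2 ∂(bondPercolation (zdGraph 3) (criticalProbI 3))) ^ 2)) := by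
  intro r c
  dsimp only
  -- mirror symmetry of the first two moments (before introducing names)
  have hI₁ := integral_mirror_eq r
  have hI₂ := integral_mirror_sq_eq r
  -- names
  set P : Measure (BondConfig (Site 3)) := bondPercolation (zdGraph 3) (criticalProbI 3) with hP
  set K : Finset (Sym2 (Site 3)) :=
    armEdges (r / 8) (0 : Site 3) ∪ armEdges (r / 8) ![(r : ℤ), (r : ℤ), 0] ∪
      armEdges (r / 8) ![(r : ℤ), 0, (r : ℤ)] ∪ armEdges (r / 8) ![0, (r : ℤ), (r : ℤ)] with hK
  set A : Set (BondConfig (Site 3)) := openConn (0 : Site 3) ![(r : ℤ), (r : ℤ), 0] with hA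
  set B : Set (BondConfig (Site 3)) := openConn ![(r : ℤ), 0, (r : ℤ)] ![0, (r : ℤ), (r : ℤ)] with hB
  set f : BondConfig (Site 3) → ℝ := blockCondProb (zdGraph 3) (criticalProbI 3) K A with hf
  set g : BondConfig (Site 3) → ℝ := blockCondProb (zdGraph 3) (criticalProbI 3) K B with hg
  -- measurability, bounds, integrability
  have hAm : MeasurableSet A := measurableSet_openConn_holds _ _
  have hBm : MeasurableSet B := measurableSet_openConn_holds _ _
  have hfm : Measurable f := measurable_blockCondProb _ _ K hAm
  have hgm : Measurable g := measurable_blockCondProb _ _ K hBm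
  have hf0 : ∀ ω, 0 ≤ f ω := fun ω => blockCondProb_nonneg _ _ K A ω
  have hf1 : ∀ ω, f ω ≤ 1 := fun ω => blockCondProb_le_one _ _ K A ω
  have hg0 : ∀ ω, 0 ≤ g ω := fun ω => blockCondProb_nonneg _ _ K B ω
  have hg1 : ∀ ω, g ω ≤ 1 := fun ω => blockCondProb_le_one _ _ K B ω
  have hfi : Integrable f P := by
    simpa [hP] using integrable_blockCondProb (zdGraph 3) (criticalProbI 3) K hAm
  have hgi : Integrable g P := by
    simpa [hP] using integrable_blockCondProb (zdGraph 3) (criticalProbI 3) K hBm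
  have hf2i : Integrable (fun ω => f ω ^ 2) P := by
    refine Integrable.of_bound (hfm.pow_const 2).aestronglyMeasurable 1 (ae_of_all _ fun ω => ?_)
    rw [Real.norm_eq_abs, abs_of_nonneg (sq_nonneg _)]
    nlinarith [hf0 ω, hf1 ω]
  have hg2i : Integrable (fun ω => g ω ^ 2) P := by
    refine Integrable.of_bound (hgm.pow_const 2).aestronglyMeasurable 1 (ae_of_all _ fun ω => ?_)
    rw [Real.norm_eq_abs, abs_of_nonneg (sq_nonneg _)]
    nlinarith [hg0 ω, hg1 ω]
  have hfgi : Integrable (fun ω => f ω * g ω) P := by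
    simpa [hP] using integrable_blockCondProb_mul (zdGraph 3) (criticalProbI 3) K hAm hBm
  have h2fg : Integrable (fun ω => 2 * (f ω * g ω)) P := hfgi.const_mul 2
  -- expansion of the four symmetrised integrals
  have e₁ : ∫ ω, ((f ω - g ω) / 2) ^ 2 ∂P =
      (∫ ω, f ω ^ 2 ∂P - 2 * ∫ ω, f ω * g ω ∂P + ∫ ω, g ω ^ 2 ∂P) / 4 := by
    have : (fun ω => ((f ω - g ω) / 2) ^ 2) =
        fun ω => (f ω ^ 2 - 2 * (f ω * g ω) + g ω ^ 2) / 4 := by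
      funext ω; ring
    have hq : Integrable (fun ω => f ω ^ 2 - 2 * (f ω * g ω)) P := hf2i.sub h2fg
    rw [this, integral_div, integral_add hq hg2i, integral_sub hf2i h2fg, integral_const_mul]
  have e₂ : ∫ ω, (f ω - g ω) / 2 ∂P = (∫ ω, f ω ∂P - ∫ ω, g ω ∂P) / 2 := by
    rw [integral_div, integral_sub hfi hgi]
  have e₃ : ∫ ω, ((f ω + g ω) / 2) ^ 2 ∂P =
      (∫ ω, f ω ^ 2 ∂P + 2 * ∫ ω, f ω * g ω ∂P + ∫ ω, g ω ^ 2 ∂P) / 4 := by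
    have : (fun ω => ((f ω + g ω) / 2) ^ 2) =
        fun ω => (f ω ^ 2 + 2 * (f ω * g ω) + g ω ^ 2) / 4 := by
      funext ω; ring
    have hq : Integrable (fun ω => f ω ^ 2 + 2 * (f ω * g ω)) P := hf2i.add h2fg
    rw [this, integral_div, integral_add hq hg2i, integral_add hf2i h2fg, integral_const_mul]
  have e₄ : ∫ ω, (f ω + g ω) / 2 ∂P = (∫ ω, f ω ∂P + ∫ ω, g ω ∂P) / 2 := by
    rw [integral_div, integral_add hfi hgi]
  rw [e₁, e₂, e₃, e₄, hI₁, hI₂]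
  constructor <;> intro h <;> nlinarith [h]

end Summit.CriticalPhenomena.PercolationContinuityZ3.Theorems.TetrahedronHarrisGap

end
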